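import Summits.Ventures.Crystal3D.Theorems.StickyWulffConstantGenericWallFloorWalkMoves
import HarnessLib

/-!
# Steering lemma (fcc dozen): a slot that climbs AND moves inward

HONEST FRAMING. Venture `Summits/Ventures/Crystal3D` (cell `crystal3d-full`), helper for the crux
`GenericWallFloor` (stmt-Ventures-19480) of `route-Ventures-StickyWulffConstant`, REGISTERED line `WallLedgerG`,
open stub `stub_twoSlabAdhesion` (general fillings; ARCH v4 «coherent walks in tubes», lemma (S)).  Rung credit
only; F-C1 not moved.

`exists_steering_slot`: for every frame `A` and every ORTHONORMAL pair `z, q` («up», «inward») some slot `w` has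
`⟪A w, z⟫ ≥ 1/32` and `⟪A w, q⟫ ≥ 1/32`.  (Numerically the optimum is `(2 − √2)/4 ≈ 0.146`, kit j292269 certifies
`≥ 0.14` for the fcc AND the twin dozen by Lipschitz branch-and-bound; the twin-dozen version is not proved here.)
This is what lets a coherent walker at a full-shell ball rise by `≥ 1/32` per step while staying in a vertical tube.
Proof: `u` := steep slot for `(z + q)/√2` (`exists_steep_slot`), so `⟪A u, z⟫ + ⟪A u, q⟫ ≥ 1`; if one summand is
`< 1/32` then `A u` is within `1/4` of (say) `z`; `v` := steep slot for `q`; the menu value `γ = ⟪u, v⟫` decides: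
`γ ∈ {1, ½}` ⇒ `v` itself; `γ = −½` ⇒ the slot `u + v`; `γ = −1` impossible; `γ = 0` ⇒ one of the two COMMON
NEIGHBOURS `p, u + v − p` of the orthogonal slots `u, v` (`exists_common_neighbour_of_orthogonal`, from the slot
frame identity `Σ_w ⟪w, x⟫² = 4‖x‖²` at `x = u + v`).
WHAT THIS IS NOT: not the stub; the twin-dozen steering and the tube assembly remain; F-C1 not moved.
-/

noncomputable section

namespace Summit.Ventures.Crystal3D.Theorems

open Summit.Ventures.Crystal3D Finset
open Literature.MathematicalPhysics.StatisticalMechanics (fccStacking)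
open scoped InnerProductSpace

/-- Bessel for two orthonormal vectors: `⟪x, z⟫² + ⟪x, q⟫² ≤ ‖x‖²`. -/
theorem inner_sq_add_inner_sq_le (x z q : EuclideanSpace ℝ (Fin 3)) (hz : ‖z‖ = 1) (hq : ‖q‖ = 1)
    (hzq : ⟪z, q⟫_ℝ = 0) : ⟪x, z⟫_ℝ ^ 2 + ⟪x, q⟫_ℝ ^ 2 ≤ ‖x‖ ^ 2 := by
  have h := real_inner_self_nonneg (x := x - ⟪x, z⟫_ℝ • z - ⟪x, q⟫_ℝ • q)
  have hzz : ⟪z, z⟫_ℝ = 1 := by rw [real_inner_self_eq_norm_sq, hz, one_pow]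
  have hqq : ⟪q, q⟫_ℝ = 1 := by rw [real_inner_self_eq_norm_sq, hq, one_pow]
  have hqz : ⟪q, z⟫_ℝ = 0 := by rw [real_inner_comm, hzq]
  have hxx : ⟪x, x⟫_ℝ = ‖x‖ ^ 2 := real_inner_self_eq_norm_sq x
  have e1 : ⟪z, x⟫_ℝ = ⟪x, z⟫_ℝ := real_inner_comm _ _
  have e2 : ⟪q, x⟫_ℝ = ⟪x, q⟫_ℝ := real_inner_comm _ _
  simp only [inner_sub_left, inner_sub_right, inner_smul_left, inner_smul_right, hzz, hqq, hzq, hqz, e1, e2,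
    conj_trivial] at h
  nlinarith [h, hxx]

/-- **Common neighbour of two orthogonal slots.**  If `⟪u, v⟫ = 0` for slots `u, v` then some slot `p` has
`⟪p, u⟫ = ⟪p, v⟫ = 1/2` (and then `u + v − p` is the other one). -/
theorem exists_common_neighbour_of_orthogonal {u v : EuclideanSpace ℝ (Fin 3)} (hu : u ∈ fccSlots)
    (hv : v ∈ fccSlots) (huv : ⟪u, v⟫_ℝ = 0) :
    ∃ p ∈ fccSlots, ⟪p, u⟫_ℝ = 1 / 2 ∧ ⟪p, v⟫_ℝ = 1 / 2 := by
  classical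
  have hu1 := norm_eq_one_of_mem_fccSlots hu
  have hv1 := norm_eq_one_of_mem_fccSlots hv
  have hvu : ⟪v, u⟫_ℝ = 0 := by rw [real_inner_comm, huv]
  -- it suffices to find a slot with both values `1/2` or both `−1/2`
  suffices h : ∃ p ∈ fccSlots, (⟪p, u⟫_ℝ = 1 / 2 ∧ ⟪p, v⟫_ℝ = 1 / 2) ∨ (⟪p, u⟫_ℝ = -(1 / 2) ∧ ⟪p, v⟫_ℝ = -(1 / 2)) by
    obtain ⟨p, hp, h | h⟩ := h
    · exact ⟨p, hp, h⟩
    · exact ⟨-p, neg_mem_fccSlots hp, by rw [inner_neg_left, h.1, neg_neg], by rw [inner_neg_left, h.2, neg_neg]⟩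
  by_contra hne
  push Not at hne
  have menu : ∀ {p}, p ∈ fccSlots → ∀ {w}, w ∈ fccSlots →
      ⟪p, w⟫_ℝ = 1 ∨ ⟪p, w⟫_ℝ = 1 / 2 ∨ ⟪p, w⟫_ℝ = 0 ∨ ⟪p, w⟫_ℝ = -(1 / 2) ∨ ⟪p, w⟫_ℝ = -1 :=
    fun hp _ hw => inner_mem_of_unit_slots (LinearIsometryEquiv.refl ℝ (EuclideanSpace ℝ (Fin 3)))
      ⟨_, mem_fcc_of_mem_fccSlots hp, rfl⟩ ⟨_, mem_fcc_of_mem_fccSlots hw, rfl⟩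
      (norm_eq_one_of_mem_fccSlots hp) (norm_eq_one_of_mem_fccSlots hw)
  -- unit vectors with inner product `±1` are equal / opposite
  have eq_of_one : ∀ {p w : EuclideanSpace ℝ (Fin 3)}, ‖p‖ = 1 → ‖w‖ = 1 → ⟪p, w⟫_ℝ = 1 → p = w := by
    intro p w hp hw h
    have : ‖p - w‖ ^ 2 = 0 := by rw [norm_sub_sq_real, hp, hw, h]; ring
    rwa [sq_eq_zero_iff, norm_eq_zero, sub_eq_zero] at this
  have eq_of_neg_one : ∀ {p w : EuclideanSpace ℝ (Fin 3)}, ‖p‖ = 1 → ‖w‖ = 1 → ⟪p, w⟫_ℝ = -1 → p = -w := by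
    intro p w hp hw h
    have : ‖p + w‖ ^ 2 = 0 := by rw [norm_add_sq_real, hp, hw, h]; ring
    rw [sq_eq_zero_iff, norm_eq_zero] at this
    exact eq_neg_of_add_eq_zero_left this
  set S : Finset (EuclideanSpace ℝ (Fin 3)) := {u, -u, v, -v} with hS
  -- termwise bound
  have hterm : ∀ p ∈ fccSlots, ⟪p, u + v⟫_ℝ ^ 2 ≤ 1 / 4 + 3 / 4 * (if p ∈ S then 1 else 0) := by
    intro p hp
    have hp1 := norm_eq_one_of_mem_fccSlots hp
    rw [inner_add_right]
    by_cases hpS : p ∈ S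
    · rw [if_pos hpS]
      simp only [hS, Finset.mem_insert, Finset.mem_singleton] at hpS
      have hpp : ⟪u, u⟫_ℝ = 1 := by rw [real_inner_self_eq_norm_sq, hu1, one_pow]
      have hvv : ⟪v, v⟫_ℝ = 1 := by rw [real_inner_self_eq_norm_sq, hv1, one_pow]
      rcases hpS with rfl | rfl | rfl | rfl
      · rw [hpp, huv]; norm_num
      · rw [inner_neg_left, inner_neg_left, hpp, huv]; norm_num
      · rw [hvu, hvv]; norm_num
      · rw [inner_neg_left, inner_neg_left, hvu, hvv]; norm_num
    · rw [if_neg hpS]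
      simp only [hS, Finset.mem_insert, Finset.mem_singleton, not_or] at hpS
      obtain ⟨h1, h2, h3, h4⟩ := hpS
      have hne' := hne p hp
      rcases menu hp hu with a | a | a | a | a
      · exact absurd (eq_of_one hp1 hu1 a) h1
      rotate_left
      rotate_left
      rotate_left
      · exact absurd (eq_of_neg_one hp1 hu1 a) h2
      all_goals
        rcases menu hp hv with b | b | b | b | b
        · exact absurd (eq_of_one hp1 hv1 b) h3
        rotate_left
        rotate_left
        rotate_left
        · exact absurd (eq_of_neg_one hp1 hv1 b) h4
        all_goals
          rw [a, b] at hne' ⊢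
          first
          | exact absurd rfl (hne'.1 rfl)
          | exact absurd rfl (hne'.2 rfl)
          | norm_num
  -- sum: `8 = Σ ⟪p, u+v⟫² ≤ 3 + 3/4 · #S ≤ 6`
  have hid := sum_slots_inner_sq (u + v)
  have hnorm : ‖u + v‖ ^ 2 = 2 := by rw [norm_add_sq_real, hu1, hv1, huv]; norm_num
  rw [hnorm] at hid
  have hle := Finset.sum_le_sum hterm
  rw [hid, Finset.sum_add_distrib, Finset.sum_const, card_fccSlots, ← Finset.mul_sum, Finset.sum_boole] at hle
  have hcard : ((fccSlots.filter fun p => p ∈ S).card : ℝ) ≤ 4 := by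
    have h1 : (fccSlots.filter fun p => p ∈ S).card ≤ S.card :=
      card_le_card (fun p hp => (mem_filter.1 hp).2)
    have h2 : S.card ≤ 4 := by
      rw [hS]
      refine (Finset.card_insert_le _ _).trans ?_
      refine (Nat.succ_le_succ (Finset.card_insert_le _ _)).trans ?_
      refine (Nat.succ_le_succ (Nat.succ_le_succ (Finset.card_insert_le _ _))).trans ?_
      rw [Finset.card_singleton]
    exact_mod_cast h1.trans h2
  norm_num at hle
  linarith

/-- One-sided steering step (see `exists_steering_slot`): `⟪A u, z⟫ + ⟪A u, q⟫ ≥ 1` with a small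
`q`-component forces a slot with both components `≥ 1/32`. -/
theorem exists_steering_slot_aux (A : EuclideanSpace ℝ (Fin 3) ≃ₗᵢ[ℝ] EuclideanSpace ℝ (Fin 3))
    {z q u : EuclideanSpace ℝ (Fin 3)} (hz : ‖z‖ = 1) (hq : ‖q‖ = 1)
    (hu : u ∈ fccSlots) (hsum : 1 ≤ ⟪A u, z⟫_ℝ + ⟪A u, q⟫_ℝ) (hb : ⟪A u, q⟫_ℝ < 1 / 32) :
    ∃ w ∈ fccSlots, (1 / 32 : ℝ) ≤ ⟪A w, z⟫_ℝ ∧ (1 / 32 : ℝ) ≤ ⟪A w, q⟫_ℝ := by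
  have h2 : (1.4 : ℝ) < Real.sqrt 2 := by
    rw [show (1.4 : ℝ) = Real.sqrt (1.4 ^ 2) by rw [Real.sqrt_sq (by norm_num)]]
    exact Real.sqrt_lt_sqrt (by norm_num) (by norm_num)
  have slot1 : ∀ {w}, w ∈ fccSlots → ‖A w‖ = 1 := fun hw => by
    rw [LinearIsometryEquiv.norm_map, norm_eq_one_of_mem_fccSlots hw]
  have slotΛ : ∀ {w}, w ∈ fccSlots → A w ∈ A '' fccStacking 1 (Real.sqrt (2 / 3)) :=
    fun hw => ⟨_, mem_fcc_of_mem_fccSlots hw, rfl⟩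
  have hu1 := slot1 hu
  -- `⟪A u, z⟫ ≤ 1`, so `A u` is within `1/4` of `z`
  have ha1 : ⟪A u, z⟫_ℝ ≤ 1 := by
    have := abs_real_inner_le_norm (A u) z; rw [hu1, hz, one_mul] at this; exact (abs_le.1 this).2
  have hclose : ‖z - A u‖ < 1 / 4 := by
    have hsq : ‖z - A u‖ ^ 2 < (1 / 4) ^ 2 := by
      rw [norm_sub_sq_real, hz, hu1, real_inner_comm]; nlinarith
    by_contra hge
    push Not at hge
    nlinarith [norm_nonneg (z - A u)]
  have near : ∀ x : EuclideanSpace ℝ (Fin 3), ‖x‖ = 1 → ⟪x, A u⟫_ℝ - 1 / 4 < ⟪x, z⟫_ℝ := by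
    intro x hx
    have h := abs_real_inner_le_norm x (z - A u)
    rw [hx, one_mul, inner_sub_right] at h
    have := (abs_le.1 h).1
    linarith
  -- the steep slot for `q`
  obtain ⟨v, hvΛ, hvn, hvq⟩ := exists_steep_slot (A.symm q) (by rw [LinearIsometryEquiv.norm_map, hq])
  have hv : v ∈ fccSlots := mem_fccSlots_of_unit hvΛ hvn
  have hβ : Real.sqrt 2 / 2 ≤ ⟪A v, q⟫_ℝ := by
    rwa [← LinearIsometryEquiv.inner_map_map A v, LinearIsometryEquiv.apply_symm_apply] at hvq
  have hv1 := slot1 hv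
  by_cases hvz : (1 / 32 : ℝ) ≤ ⟪A v, z⟫_ℝ
  · exact ⟨v, hv, hvz, by linarith⟩
  push Not at hvz
  have hγz := near (A v) hv1
  rcases inner_mem_of_unit_slots A (slotΛ hv) (slotΛ hu) hv1 hu1 with hγ | hγ | hγ | hγ | hγ
  · rw [hγ] at hγz; linarith
  · rw [hγ] at hγz; linarith
  · -- orthogonal: the common neighbours
    rw [LinearIsometryEquiv.inner_map_map] at hγ
    have hγ' : ⟪u, v⟫_ℝ = 0 := by rw [real_inner_comm]; exact hγ
    obtain ⟨p, hp, hpv, hpu⟩ := exists_common_neighbour_of_orthogonal hv hu hγ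
    have hp1 := norm_eq_one_of_mem_fccSlots hp
    -- the partner `p' = u + v − p`
    have hp' : u + v - p ∈ fccSlots := by
      refine mem_fccSlots_of_unit ?_ ?_
      · rw [sub_eq_add_neg]
        exact fcc_add_site_mem (fcc_add_site_mem (mem_fcc_of_mem_fccSlots hu) (mem_fcc_of_mem_fccSlots hv))
          (mem_fcc_of_mem_fccSlots (neg_mem_fccSlots hp))
      · have huv1 : ‖u + v‖ ^ 2 = 2 := by
          rw [norm_add_sq_real, norm_eq_one_of_mem_fccSlots hu, norm_eq_one_of_mem_fccSlots hv, hγ']; norm_num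
        have : ‖u + v - p‖ ^ 2 = 1 := by
          rw [norm_sub_sq_real, huv1, hp1, inner_add_left, real_inner_comm, hpu, real_inner_comm, hpv]; norm_num
        nlinarith [norm_nonneg (u + v - p)]
    -- `z`-components of both partners exceed `1/4`
    have hpz : 1 / 4 < ⟪A p, z⟫_ℝ := by
      have := near (A p) (slot1 hp); rw [LinearIsometryEquiv.inner_map_map, hpu] at this; linarith
    have hp'z : 1 / 4 < ⟪A (u + v - p), z⟫_ℝ := by
      have := near (A (u + v - p)) (slot1 hp')
      rw [LinearIsometryEquiv.inner_map_map, inner_sub_left, inner_add_left, real_inner_self_eq_norm_sq,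
        norm_eq_one_of_mem_fccSlots hu, hγ, hpu] at this
      linarith
    -- `q`-components sum to `⟪A u, q⟫ + ⟪A v, q⟫ ≥ √2/2`
    have hsumq : ⟪A p, q⟫_ℝ + ⟪A (u + v - p), q⟫_ℝ = ⟪A u, q⟫_ℝ + ⟪A v, q⟫_ℝ := by
      rw [map_sub, map_add, inner_sub_left, inner_add_left]; ring
    have hbq : 0 ≤ ⟪A u, q⟫_ℝ := by linarith
    rcases le_or_gt (Real.sqrt 2 / 4) ⟪A p, q⟫_ℝ with h | h
    · exact ⟨p, hp, by linarith, by linarith⟩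
    · exact ⟨u + v - p, hp', by linarith, by linarith⟩
  · -- `γ = −1/2`: the slot `u + v`
    rw [LinearIsometryEquiv.inner_map_map] at hγ
    have hneg : ⟪v, u⟫_ℝ < 0 := by rw [hγ]; norm_num
    rcases eq_neg_or_add_mem_fccSlots_of_inner_neg hu hv hneg with hvu | hw
    · exfalso
      rw [hvu, inner_neg_left, real_inner_self_eq_norm_sq, norm_eq_one_of_mem_fccSlots hu] at hγ; norm_num at hγ
    · refine ⟨u + v, hw, ?_, ?_⟩
      · rw [map_add, inner_add_left]
        rw [LinearIsometryEquiv.inner_map_map, hγ] at hγz; linarith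
      · rw [map_add, inner_add_left]; linarith
  · -- `γ = −1`: `A v = −A u`, contradicting steepness for `q`
    exfalso
    have : ‖A v + A u‖ ^ 2 = 0 := by rw [norm_add_sq_real, hv1, hu1, hγ]; ring
    rw [sq_eq_zero_iff, norm_eq_zero] at this
    have hvu : A v = -A u := eq_neg_of_add_eq_zero_left this
    rw [hvu, inner_neg_left] at hβ
    linarith

/-- **Steering lemma (fcc dozen).**  For every frame `A` and orthonormal `z, q` some slot `w` has
`⟪A w, z⟫ ≥ 1/32` and `⟪A w, q⟫ ≥ 1/32`. -/
theorem exists_steering_slot (A : EuclideanSpace ℝ (Fin 3) ≃ₗᵢ[ℝ] EuclideanSpace ℝ (Fin 3))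
    {z q : EuclideanSpace ℝ (Fin 3)} (hz : ‖z‖ = 1) (hq : ‖q‖ = 1) (hzq : ⟪z, q⟫_ℝ = 0) :
    ∃ w ∈ fccSlots, (1 / 32 : ℝ) ≤ ⟪A w, z⟫_ℝ ∧ (1 / 32 : ℝ) ≤ ⟪A w, q⟫_ℝ := by
  have h22 : Real.sqrt 2 * Real.sqrt 2 = 2 := Real.mul_self_sqrt (by norm_num)
  have hqz : ⟪q, z⟫_ℝ = 0 := by rw [real_inner_comm, hzq]
  -- the unit vector `ν = (z + q)/√2` and its steep slot
  set ν : EuclideanSpace ℝ (Fin 3) := (Real.sqrt 2 / 2) • (z + q) with hν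
  have hν1 : ‖ν‖ = 1 := by
    have hzq2 : ‖z + q‖ ^ 2 = 2 := by rw [norm_add_sq_real, hz, hq, hzq]; norm_num
    have : ‖ν‖ ^ 2 = 1 := by
      rw [hν, norm_smul, mul_pow, hzq2, Real.norm_eq_abs, sq_abs, div_pow, Real.sq_sqrt (by norm_num)]; norm_num
    nlinarith [norm_nonneg ν]
  obtain ⟨u, huΛ, hun, huν⟩ := exists_steep_slot (A.symm ν) (by rw [LinearIsometryEquiv.norm_map, hν1])
  have hu : u ∈ fccSlots := mem_fccSlots_of_unit huΛ hun
  rw [← LinearIsometryEquiv.inner_map_map A u, LinearIsometryEquiv.apply_symm_apply, hν, inner_smul_right,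
    inner_add_right] at huν
  have hsum : 1 ≤ ⟪A u, z⟫_ℝ + ⟪A u, q⟫_ℝ := by
    have hs : 0 < Real.sqrt 2 := Real.sqrt_pos.2 (by norm_num)
    nlinarith
  by_cases hb : ⟪A u, q⟫_ℝ < 1 / 32
  · exact exists_steering_slot_aux A hz hq hu hsum hb
  by_cases ha : ⟪A u, z⟫_ℝ < 1 / 32
  · obtain ⟨w, hw, h1, h2⟩ := exists_steering_slot_aux A hq hz hu (by linarith) ha
    exact ⟨w, hw, h2, h1⟩
  · push Not at ha hb
    exact ⟨u, hu, ha, hb⟩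

end Summit.Ventures.Crystal3D.Theorems

end
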